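import Summits.CriticalPhenomena.SAWScalingLimit.Theses.SAWReversalUpgrade
import Summits.CriticalPhenomena.SAWScalingLimit.Theorems.SubseqIdentification.Negative.ProbabilityRedundant
import Summits.CriticalPhenomena.SAWScalingLimit.Theorems.ObservableToSLE.Negative.EndpointNecessity
import Literature.Probability.RandomPlanarGeometry.SAWScalingLimitFamily
import Literature.Barriers.CriticalPhenomena.SupercriticalSAWSpaceFillingTuned

/-!
# Load-bearing structure of crux `SAWReversalUpgrade.NoDeepReturn` (stmt-CriticalPhenomena-18004):
# time order, `ε > 0`, `r = r(ε)`, small mesh, and `r < |a - b|`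

Refuter (cdisprove, cycle 1), hypothesis mutation of the crux
`Summit.CriticalPhenomena.SAWScalingLimit.Theses.SAWReversalUpgrade.NoDeepReturn`:

    ∀ D a b, SAW.IsEndpointApprox D a b → ∀ ε > 0, ∀ η > 0, ∃ r > 0, ∀ᶠ δ in 𝓝[>] 0,
      law D.carrier δ (a δ) (b δ) {γ | ∃ s < t, ε ≤ dist (poly γ s) (D.pt 0) ∧ dist (poly γ t) (D.pt 0) ≤ r} ≤ ofReal η.

Companion of the landed `SAWReversalUpgradeEndpointLoadBearing.lean` (the endpoint LIMITS are
load-bearing). Here, for EVERY Dobrushin domain and EVERY endpoint approximation (so the witnesses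
live inside the crux's own range of data; existence: `SAW.exists_isEndpointApprox`):

* `noDeepReturn_false_without_order` — drop the time order `s < t` ("far somewhere, close
  somewhere"): false, `(s, t) = (1, 0)` (end far, start close) is in the event for every walk.
* `noDeepReturn_false_with_eps_zero` — weaken `0 < ε` to `0 ≤ ε`: false at `ε = 0`, the polyline is
  within `r` of `a` just after its start (intermediate value theorem on `t ↦ dist (poly γ t) a`).
* `not_noDeepReturn_uniformInEps` — the radius `r` cannot be chosen before `ε` (`∃ r ∀ ε`): with
  `ε ≤ r/2` every walk crosses the levels `r/2` and then `r` on its way out (two intermediate values).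
* `not_noDeepReturn_allMesh` — `∀ᶠ δ` cannot be replaced by `∀ δ > 0`: in the unit disc, at meshes
  `δ ∈ [1/4, 1/2)` bounded AWAY from `0` (where `IsEndpointApprox` says nothing) the lattice sweeps
  the vertex `2δ → 1 = D.pt 0`; endpoints `0 ↦ 2δ·e₁… ` i.e. `a δ = (0,0)`, `b δ = (2,0)` make the
  deep return certain (`(s,t) = (0,1)`), law `1 > 1/2`, for every `r`.
* `r_lt_dist_of_noDeepReturnBound` — tightness of the conclusion: any admissible radius satisfies
  `r < dist (D.pt 0) (D.pt 1)` once `ε < dist (D.pt 0) (D.pt 1)` and `η < 1` (the walk ends at `b`).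

All statements are about the crux's own hypotheses/quantifier structure; no positive route item is
asserted. The crux itself is untouched — it is a necessary condition of the conjunct
(`Cruxes/NoDeepReturn/NoDeepReturnNecessary.lean`, strategist, kernel-checked).
-/

noncomputable section

open Literature.Probability.RandomPlanarGeometry Literature.Probability.RandomPlanarGeometry.SAW
  Literature.Probability.LatticeModels MeasureTheory Filter Topology Set Metric
open scoped NNReal ENNReal

namespace Summit.CriticalPhenomena.SAWScalingLimit.Theorems.NoDeepReturn.Negative

open Summit.CriticalPhenomena.SAWScalingLimit.Theorems.ObservableToSLE.Negative (walk_toCurve_apply_one)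
open Summit.CriticalPhenomena.SAWScalingLimit.Theorems.SubseqIdentification.Negative
  (eventually_isProbabilityMeasure_law)

/-! ### Intermediate values of `t ↦ dist (γ t) p` along a continuous curve on `[0, 1]` -/

/-- A continuous curve on `[0,1]` that starts strictly inside the sphere `dist · p = c` and ends
on or outside it meets the sphere at a POSITIVE time. [folklore] -/
theorem exists_pos_dist_eq (γ : C(unitInterval, ℂ)) (p : ℂ) {c : ℝ}
    (h0 : dist (γ 0) p < c) (h1 : c ≤ dist (γ 1) p) :
    ∃ t : unitInterval, 0 < t ∧ dist (γ t) p = c := by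
  set g : ℝ → ℝ := fun u => dist (γ (Set.projIcc (0 : ℝ) 1 zero_le_one u)) p with hg
  have hgc : Continuous g := (γ.continuous.comp continuous_projIcc).dist continuous_const
  have hg0 : g 0 = dist (γ 0) p := by
    simp only [hg, Set.projIcc_left]; rfl
  have hg1 : g 1 = dist (γ 1) p := by
    simp only [hg, Set.projIcc_right]; rfl
  obtain ⟨t₀, ht₀, hgt⟩ : c ∈ g '' Set.Icc (0 : ℝ) 1 :=
    intermediate_value_Icc zero_le_one hgc.continuousOn
      ⟨by rw [hg0]; exact h0.le, by rwa [hg1]⟩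
  have hne : t₀ ≠ 0 := by
    rintro rfl
    rw [hg0] at hgt
    linarith
  have hpos : (0 : ℝ) < t₀ := lt_of_le_of_ne ht₀.1 (Ne.symm hne)
  refine ⟨⟨t₀, ht₀⟩, ?_, ?_⟩
  · rw [← Subtype.coe_lt_coe]
    exact_mod_cast hpos
  · simpa only [hg, Set.projIcc_of_mem zero_le_one ht₀] using hgt

/-- A continuous curve on `[0,1]` starting strictly inside the sphere of radius `c₁` about `p`
and ending on or outside the sphere of radius `c₂ > c₁` meets the `c₁`-sphere at a time `s` and
the `c₂`-sphere at a LATER time `t`. [folklore] -/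
theorem exists_lt_dist_eq_dist_eq (γ : C(unitInterval, ℂ)) (p : ℂ) {c₁ c₂ : ℝ}
    (h0 : dist (γ 0) p < c₁) (h12 : c₁ < c₂) (h1 : c₂ ≤ dist (γ 1) p) :
    ∃ s t : unitInterval, s < t ∧ dist (γ s) p = c₁ ∧ dist (γ t) p = c₂ := by
  set g : ℝ → ℝ := fun u => dist (γ (Set.projIcc (0 : ℝ) 1 zero_le_one u)) p with hg
  have hgc : Continuous g := (γ.continuous.comp continuous_projIcc).dist continuous_const
  have hg0 : g 0 = dist (γ 0) p := by
    simp only [hg, Set.projIcc_left]; rfl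
  have hg1 : g 1 = dist (γ 1) p := by
    simp only [hg, Set.projIcc_right]; rfl
  obtain ⟨t₀, ht₀, hgt⟩ : c₂ ∈ g '' Set.Icc (0 : ℝ) 1 :=
    intermediate_value_Icc zero_le_one hgc.continuousOn
      ⟨by rw [hg0]; linarith, by rwa [hg1]⟩
  obtain ⟨s₀, hs₀, hgs⟩ : c₁ ∈ g '' Set.Icc (0 : ℝ) t₀ :=
    intermediate_value_Icc ht₀.1 hgc.continuousOn
      ⟨by rw [hg0]; exact h0.le, by rw [hgt]; exact h12.le⟩
  have hs₀1 : s₀ ∈ Set.Icc (0 : ℝ) 1 := ⟨hs₀.1, hs₀.2.trans ht₀.2⟩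
  have hne : s₀ ≠ t₀ := by
    rintro rfl
    rw [hgs] at hgt
    exact h12.ne hgt
  have hlt : s₀ < t₀ := lt_of_le_of_ne hs₀.2 hne
  refine ⟨⟨s₀, hs₀1⟩, ⟨t₀, ht₀⟩, Subtype.mk_lt_mk.2 hlt, ?_, ?_⟩
  · simpa only [hg, Set.projIcc_of_mem zero_le_one hs₀1] using hgs
  · simpa only [hg, Set.projIcc_of_mem zero_le_one ht₀] using hgt

/-! ### Common consequences of an endpoint approximation -/

section Common

variable {D : DobrushinDomain} {a b : ℝ → Site 2}

/-- The marked points are distinct, so their distance is positive. [folklore] -/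
theorem dist_pt_pos (D : DobrushinDomain) : 0 < dist (D.pt 1) (D.pt 0) :=
  dist_pos.2 fun h' => absurd (D.pt_injective h') (by decide)

/-- The starting mesh point is eventually within any `c > 0` of `a = D.pt 0`. [folklore] -/
theorem eventually_dist_start_lt (hab : IsEndpointApprox D a b) {c : ℝ} (hc : 0 < c) :
    ∀ᶠ δ in 𝓝[>] (0 : ℝ), dist (meshPoint δ (a δ)) (D.pt 0) < c :=
  Metric.tendsto_nhds.1 hab.tendsto_fst c hc

/-- The final mesh point is eventually farther than any `c < dist b a` from `a = D.pt 0`.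
[folklore] -/
theorem eventually_lt_dist_end (hab : IsEndpointApprox D a b) {c : ℝ}
    (hc : c < dist (D.pt 1) (D.pt 0)) :
    ∀ᶠ δ in 𝓝[>] (0 : ℝ), c < dist (meshPoint δ (b δ)) (D.pt 0) := by
  have h : ∀ᶠ δ in 𝓝[>] (0 : ℝ),
      dist (meshPoint δ (b δ)) (D.pt 1) < dist (D.pt 1) (D.pt 0) - c :=
    Metric.tendsto_nhds.1 hab.tendsto_snd _ (by linarith)
  filter_upwards [h] with δ hδ
  have htri := dist_triangle (D.pt 1) (meshPoint δ (b δ)) (D.pt 0)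
  rw [dist_comm] at hδ
  linarith

/-- `ofReal (1/2) < 1` in `ℝ≥0∞`. [folklore] -/
theorem ofReal_half_lt_one : ENNReal.ofReal (1 / 2 : ℝ) < 1 :=
  ENNReal.ofReal_lt_one.2 (by norm_num)

end Common

/-! ### (a) The time order `s < t` is load-bearing -/

/-- **Without the time order the bound is false for every admissible datum**: the event
"`ε`-far from `a` at SOME time and `r`-close to `a` at SOME time" contains every walk for small `δ`
(`s = 1`: the walk ends near `b`, at distance `→ dist b a ≥ 2ε`; `t = 0`: it starts near `a`), so its
law is `1 > 1/2`. Any proof of the crux must use that the close time comes AFTER the far time.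
[folklore] -/
theorem noDeepReturn_false_without_order (D : DobrushinDomain) (a b : ℝ → Site 2)
    (hab : IsEndpointApprox D a b) :
    ¬ (∀ ε : ℝ, 0 < ε → ∀ η : ℝ, 0 < η → ∃ r : ℝ, 0 < r ∧ ∀ᶠ δ in 𝓝[>] (0 : ℝ),
        law D.carrier δ (a δ) (b δ) {γ | ∃ s t : unitInterval,
          ε ≤ dist (γ.walk.toCurve (meshPoint δ) s) (D.pt 0) ∧
          dist (γ.walk.toCurve (meshPoint δ) t) (D.pt 0) ≤ r} ≤ ENNReal.ofReal η) := by
  intro h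
  have hd := dist_pt_pos D
  obtain ⟨r, hr, hev⟩ := h (dist (D.pt 1) (D.pt 0) / 2) (half_pos hd) (1 / 2) (by norm_num)
  obtain ⟨δ, hδev, hP, hs, he⟩ := (hev.and ((eventually_isProbabilityMeasure_law hab).and
    ((eventually_dist_start_lt hab hr).and (eventually_lt_dist_end hab (half_lt_self hd))))).exists
  haveI := hP
  have key : law D.carrier δ (a δ) (b δ) Set.univ ≤ ENNReal.ofReal (1 / 2) := by
    refine le_trans (measure_mono fun γ _ => ?_) hδev
    refine ⟨1, 0, ?_, ?_⟩
    · rw [walk_toCurve_apply_one]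
      exact he.le
    · rw [SimpleGraph.Walk.toCurve_apply_zero]
      exact hs.le
  rw [measure_univ] at key
  exact absurd key (not_le.2 ofReal_half_lt_one)

/-! ### (a) `0 < ε` is load-bearing -/

/-- **With `ε = 0` allowed (`0 ≤ ε` in place of `0 < ε`) the bound is false for every admissible
datum**: at `ε = 0` the event is "within `r` of `a` at some positive time", which every walk
satisfies for small `δ` — it starts within `c := min r (|b-a|/2)` of `a` and ends beyond distance
`c`, so it is at distance exactly `c ≤ r` at some time `t > 0 = s`. [folklore] -/
theorem noDeepReturn_false_with_eps_zero (D : DobrushinDomain) (a b : ℝ → Site 2)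
    (hab : IsEndpointApprox D a b) :
    ¬ (∀ ε : ℝ, 0 ≤ ε → ∀ η : ℝ, 0 < η → ∃ r : ℝ, 0 < r ∧ ∀ᶠ δ in 𝓝[>] (0 : ℝ),
        law D.carrier δ (a δ) (b δ) {γ | ∃ s t : unitInterval, s < t ∧
          ε ≤ dist (γ.walk.toCurve (meshPoint δ) s) (D.pt 0) ∧
          dist (γ.walk.toCurve (meshPoint δ) t) (D.pt 0) ≤ r} ≤ ENNReal.ofReal η) := by
  intro h
  have hd := dist_pt_pos D
  obtain ⟨r, hr, hev⟩ := h 0 le_rfl (1 / 2) (by norm_num)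
  set c : ℝ := min r (dist (D.pt 1) (D.pt 0) / 2) with hc_def
  have hc : 0 < c := lt_min hr (half_pos hd)
  have hcr : c ≤ r := min_le_left _ _
  have hcd : c < dist (D.pt 1) (D.pt 0) := (min_le_right _ _).trans_lt (half_lt_self hd)
  obtain ⟨δ, hδev, hP, hs, he⟩ := (hev.and ((eventually_isProbabilityMeasure_law hab).and
    ((eventually_dist_start_lt hab hc).and (eventually_lt_dist_end hab hcd)))).exists
  haveI := hP
  have key : law D.carrier δ (a δ) (b δ) Set.univ ≤ ENNReal.ofReal (1 / 2) := by
    refine le_trans (measure_mono fun γ _ => ?_) hδev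
    obtain ⟨t, ht0, hdt⟩ := exists_pos_dist_eq (γ.walk.toCurve (meshPoint δ)) (D.pt 0) (c := c)
      (by rw [SimpleGraph.Walk.toCurve_apply_zero]; exact hs)
      (by rw [walk_toCurve_apply_one]; exact he.le)
    exact ⟨0, t, ht0, dist_nonneg, hdt.le.trans hcr⟩
  rw [measure_univ] at key
  exact absurd key (not_le.2 ofReal_half_lt_one)

/-! ### (c) The radius must depend on `ε`: the `ε`-uniform strengthening is false -/

/-- **`r` cannot be chosen before `ε`** (for every admissible datum): given any `r > 0`, take
`ε := c/2` with `c := min r (|b-a|/2)`; for small `δ` every walk starts within `c/2` of `a` and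
ends beyond distance `c`, so it is at distance exactly `c/2 ≥ ε` at some time `s` and at distance
exactly `c ≤ r` at a later time `t` — the deep-return event is everything, law `1 > 1/2`.
(Information for provers: `r(ε) ≤ ε`-type dependence is forced; cf. `r_lt_dist_of_noDeepReturnBound`.)
[folklore] -/
theorem not_noDeepReturn_uniformInEps (D : DobrushinDomain) (a b : ℝ → Site 2)
    (hab : IsEndpointApprox D a b) :
    ¬ (∀ η : ℝ, 0 < η → ∃ r : ℝ, 0 < r ∧ ∀ ε : ℝ, 0 < ε → ∀ᶠ δ in 𝓝[>] (0 : ℝ),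
        law D.carrier δ (a δ) (b δ) {γ | ∃ s t : unitInterval, s < t ∧
          ε ≤ dist (γ.walk.toCurve (meshPoint δ) s) (D.pt 0) ∧
          dist (γ.walk.toCurve (meshPoint δ) t) (D.pt 0) ≤ r} ≤ ENNReal.ofReal η) := by
  intro h
  have hd := dist_pt_pos D
  obtain ⟨r, hr, hev⟩ := h (1 / 2) (by norm_num)
  set c : ℝ := min r (dist (D.pt 1) (D.pt 0) / 2) with hc_def
  have hc : 0 < c := lt_min hr (half_pos hd)
  have hcr : c ≤ r := min_le_left _ _
  have hcd : c < dist (D.pt 1) (D.pt 0) := (min_le_right _ _).trans_lt (half_lt_self hd)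
  have hev' := hev (c / 2) (half_pos hc)
  obtain ⟨δ, hδev, hP, hs, he⟩ := (hev'.and ((eventually_isProbabilityMeasure_law hab).and
    ((eventually_dist_start_lt hab (half_pos hc)).and (eventually_lt_dist_end hab hcd)))).exists
  haveI := hP
  have key : law D.carrier δ (a δ) (b δ) Set.univ ≤ ENNReal.ofReal (1 / 2) := by
    refine le_trans (measure_mono fun γ _ => ?_) hδev
    obtain ⟨s, t, hst, hds, hdt⟩ := exists_lt_dist_eq_dist_eq (γ.walk.toCurve (meshPoint δ))
      (D.pt 0) (c₁ := c / 2) (c₂ := c)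
      (by rw [SimpleGraph.Walk.toCurve_apply_zero]; exact hs) (half_lt_self hc)
      (by rw [walk_toCurve_apply_one]; exact he.le)
    exact ⟨s, t, hst, hds.ge, hdt.le.trans hcr⟩
  rw [measure_univ] at key
  exact absurd key (not_le.2 ofReal_half_lt_one)

/-! ### (b) Tightness: an admissible radius is smaller than the chord `|a - b|` -/

/-- **The conclusion pins `r < dist (D.pt 0) (D.pt 1)`**: if the crux's bound holds for some
`ε < dist a b`, `η < 1` and radius `r`, then `r < dist a b`. Indeed, if `dist a b ≤ r`, every walk
(for small `δ`) crosses the level `ε` at some time `s` and is afterwards `r`-close to `a`: either at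
its end (`t = 1`, when the final mesh point is `r`-close) or when it crosses the level `r` itself
(`ε < dist a b ≤ r`); the event has law `1 > η`. [folklore] -/
theorem r_lt_dist_of_noDeepReturnBound (D : DobrushinDomain) (a b : ℝ → Site 2)
    (hab : IsEndpointApprox D a b) {ε η r : ℝ} (hε : 0 < ε)
    (hεd : ε < dist (D.pt 0) (D.pt 1)) (hη : η < 1)
    (h : ∀ᶠ δ in 𝓝[>] (0 : ℝ), law D.carrier δ (a δ) (b δ) {γ | ∃ s t : unitInterval, s < t ∧
          ε ≤ dist (γ.walk.toCurve (meshPoint δ) s) (D.pt 0) ∧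
          dist (γ.walk.toCurve (meshPoint δ) t) (D.pt 0) ≤ r} ≤ ENNReal.ofReal η) :
    r < dist (D.pt 0) (D.pt 1) := by
  by_contra hle
  push Not at hle
  rw [dist_comm] at hεd hle
  obtain ⟨δ, hδev, hP, hs, he⟩ := (h.and ((eventually_isProbabilityMeasure_law hab).and
    ((eventually_dist_start_lt hab hε).and (eventually_lt_dist_end hab hεd)))).exists
  haveI := hP
  have key : law D.carrier δ (a δ) (b δ) Set.univ ≤ ENNReal.ofReal η := by
    refine le_trans (measure_mono fun γ _ => ?_) hδev
    by_cases hγ : dist (γ.walk.toCurve (meshPoint δ) 1) (D.pt 0) ≤ r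
    · obtain ⟨s, -, hds⟩ := exists_pos_dist_eq (γ.walk.toCurve (meshPoint δ)) (D.pt 0) (c := ε)
        (by rw [SimpleGraph.Walk.toCurve_apply_zero]; exact hs)
        (by rw [walk_toCurve_apply_one]; exact he.le)
      have hs1 : s ≠ 1 := by
        rintro rfl
        rw [walk_toCurve_apply_one] at hds
        linarith
      exact ⟨s, 1, lt_of_le_of_ne unitInterval.le_one' hs1, hds.ge, hγ⟩
    · push Not at hγ
      obtain ⟨s, t, hst, hds, hdt⟩ := exists_lt_dist_eq_dist_eq (γ.walk.toCurve (meshPoint δ))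
        (D.pt 0) (c₁ := ε) (c₂ := r)
        (by rw [SimpleGraph.Walk.toCurve_apply_zero]; exact hs) (hεd.trans_le hle) hγ.le
      exact ⟨s, t, hst, hds.ge, hdt.le⟩
  rw [measure_univ] at key
  exact absurd key (not_le.2 (ENNReal.ofReal_lt_one.2 hη))

/-! ### (c) The small-mesh restriction `∀ᶠ δ` is load-bearing: the all-mesh strengthening is false -/

/-- **`∀ᶠ δ → 0⁺` cannot be replaced by `∀ δ > 0`.** Witness: the unit disc `(𝔻; 1, -1)`; any
endpoint approximation `(A, B)` (`SAW.exists_isEndpointApprox`) modified at the meshes `δ ≥ 1/4`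
only — there `a δ := (0,0)`, `b δ := (2,0)` (still an endpoint approximation: the structure only
constrains small `δ`). For `δ ∈ [1/4, 1/2)` both sites lie in `𝔻_δ` (`‖2δ‖ < 1`), the law is a
probability measure (`SupercriticalSAW.isProbabilityMeasure_lawAt`), every walk starts at `0`
(distance `1 ≥ 1/2 =: ε` from `a = 1`) and ENDS at `2δ`, at distance `1 - 2δ` from `a`; choosing
`δ := max (1/4) (1/2 - r/4)` makes `1 - 2δ ≤ r`, so the deep-return event is everything
(`(s,t) = (0,1)`), law `1 > 1/2`, for EVERY `r > 0`: the lattice sweeps vertices arbitrarily close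
to the marked point at meshes bounded away from `0`. [folklore] -/
theorem not_noDeepReturn_allMesh :
    ¬ (∀ (D : DobrushinDomain) (a b : ℝ → Site 2), IsEndpointApprox D a b →
      ∀ ε : ℝ, 0 < ε → ∀ η : ℝ, 0 < η → ∃ r : ℝ, 0 < r ∧ ∀ δ : ℝ, 0 < δ →
        law D.carrier δ (a δ) (b δ) {γ | ∃ s t : unitInterval, s < t ∧
          ε ≤ dist (γ.walk.toCurve (meshPoint δ) s) (D.pt 0) ∧
          dist (γ.walk.toCurve (meshPoint δ) t) (D.pt 0) ≤ r} ≤ ENNReal.ofReal η) := by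
  classical
  intro h
  set D : DobrushinDomain := DobrushinDomain.unitDisc with hD
  obtain ⟨A, B, hAB⟩ := exists_isEndpointApprox D
  let a : ℝ → Site 2 := fun δ => if δ < 1 / 4 then A δ else ![0, 0]
  let b : ℝ → Site 2 := fun δ => if δ < 1 / 4 then B δ else ![2, 0]
  have hsmall : ∀ᶠ δ in 𝓝[>] (0 : ℝ), δ < 1 / 4 :=
    mem_nhdsWithin_of_mem_nhds (Iio_mem_nhds (by norm_num : (0 : ℝ) < 1 / 4))
  have hea : ∀ᶠ δ in 𝓝[>] (0 : ℝ), a δ = A δ := hsmall.mono fun δ hδ => if_pos hδ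
  have heb : ∀ᶠ δ in 𝓝[>] (0 : ℝ), b δ = B δ := hsmall.mono fun δ hδ => if_pos hδ
  have hab : IsEndpointApprox D a b := by
    refine ⟨?_, ?_, ?_⟩
    · filter_upwards [hAB.reachable, hea, heb] with δ h1 h2 h3
      rw [h2, h3]
      exact h1
    · exact hAB.tendsto_fst.congr' (hea.mono fun δ hδ => by dsimp only; rw [hδ])
    · exact hAB.tendsto_snd.congr' (heb.mono fun δ hδ => by dsimp only; rw [hδ])
  have hpt0 : D.pt 0 = 1 := by
    change circleMap 0 1 (2 * Real.pi * 0) = 1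
    simp [circleMap]
  obtain ⟨r, hr, hev⟩ := h D a b hab (1 / 2) (by norm_num) (1 / 2) (by norm_num)
  -- the mesh `δ₁ ∈ [1/4, 1/2)` with `1 - 2 δ₁ ≤ r`
  set δ₁ : ℝ := max (1 / 4) (1 / 2 - r / 4) with hδ₁
  have h14 : 1 / 4 ≤ δ₁ := le_max_left _ _
  have hδ₁pos : 0 < δ₁ := by linarith
  have hδ₁lt : δ₁ < 1 / 2 := max_lt (by norm_num) (by linarith)
  have hclose : 1 - 2 * δ₁ ≤ r := by
    have := le_max_right (1 / 4 : ℝ) (1 / 2 - r / 4)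
    linarith
  have ha₁ : a δ₁ = ![0, 0] := if_neg (not_lt.2 h14)
  have hb₁ : b δ₁ = ![2, 0] := if_neg (not_lt.2 h14)
  have hm0 : meshPoint δ₁ ![0, 0] = 0 := by
    apply Complex.ext <;> simp [meshPoint, Site.toComplex]
  have hm2 : meshPoint δ₁ ![2, 0] = ((2 * δ₁ : ℝ) : ℂ) := by
    apply Complex.ext <;> simp [meshPoint, Site.toComplex] ; ring
  have hmem0 : (![0, 0] : Site 2) ∈
      meshDomain Literature.Barriers.CriticalPhenomena.SupercriticalSAW.unitDisk δ₁ := by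
    rw [Literature.Barriers.CriticalPhenomena.SupercriticalSAW.mem_meshDomain_unitDisk, hm0]
    simp
  have hmem2 : (![2, 0] : Site 2) ∈
      meshDomain Literature.Barriers.CriticalPhenomena.SupercriticalSAW.unitDisk δ₁ := by
    rw [Literature.Barriers.CriticalPhenomena.SupercriticalSAW.mem_meshDomain_unitDisk, hm2,
      Complex.norm_real, Real.norm_eq_abs, abs_of_pos (by linarith)]
    linarith
  have hxc : 0 < criticalFugacity := by
    have hμ := Literature.Probability.RandomPlanarGeometry.SAW.Zd.connectiveConstant_pos 2
    rw [Literature.Probability.RandomPlanarGeometry.SAW.Zd.connectiveConstant_two] at hμ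
    exact inv_pos.2 hμ
  haveI hP : IsProbabilityMeasure (law D.carrier δ₁ (a δ₁) (b δ₁)) := by
    rw [ha₁, hb₁]
    exact Literature.Barriers.CriticalPhenomena.SupercriticalSAW.isProbabilityMeasure_lawAt
      hδ₁pos hmem0 hmem2 hxc
  have h01 : (0 : unitInterval) < 1 := by
    rw [← Subtype.coe_lt_coe]
    norm_num
  have key : law D.carrier δ₁ (a δ₁) (b δ₁) Set.univ ≤ ENNReal.ofReal (1 / 2) := by
    refine le_trans (measure_mono fun γ _ => ?_) (hev δ₁ hδ₁pos)
    refine ⟨0, 1, h01, ?_, ?_⟩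
    · rw [SimpleGraph.Walk.toCurve_apply_zero, ha₁, hm0, hpt0]
      norm_num
    · rw [walk_toCurve_apply_one, hb₁, hm2, hpt0, Complex.dist_eq,
        show ((2 * δ₁ : ℝ) : ℂ) - 1 = ((2 * δ₁ - 1 : ℝ) : ℂ) by push_cast; ring,
        Complex.norm_real, Real.norm_eq_abs, abs_of_nonpos (by linarith)]
      linarith
  rw [measure_univ] at key
  exact absurd key (not_le.2 ofReal_half_lt_one)

end Summit.CriticalPhenomena.SAWScalingLimit.Theorems.NoDeepReturn.Negative

end
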